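import Summits.HubbardSuperconductivity.HubbardSuperconductivity.Theorems.WidthHaldaneTubeKinematics

/-!
# Local Kohn-curvature floor ⇒ twist-stiffness floor, losslessly (glue of the `kohn-curvature-path`
# line for the crux `PerWidthThermodynamics`, stmt-HubbardSuperconductivity-18510, route `SeamInduction`)

Support lemma (lead prover of the line `Ideator1Sketch`; in-line fallback composition of
`Cruxes/PerWidthThermodynamics/PICKED.md`). The idea card `kohn-curvature-path` replaces the crux's
two-point comparison `E(π/3) - E(0)` of the flux envelope `θ ↦ E_{L,M}(U; θ, N) = tubeEnergy …` by a
floor on the KOHN CURVATURE ALONG THE TWIST PATH. Here that floor is taken in its weakest, purely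
finite-difference and LOCAL form — second differences at arbitrarily small mesh only:

  `d (M/L) h² ≤ E(θ+h) + E(θ-h) - 2E(θ)` for all `θ, h` with `0 < h ≤ h₀`, `-π/3 ≤ θ-h`, `θ+h ≤ π/3`

(any `h₀ > 0`, possibly depending on everything) — and it is shown to give the endpoint bound
`E(π/3) - E(0) ≥ (d M / 2L)(π/3)²`, i.e. `d ≤ ρ̃_{L,M}` (`tubeStiffness`), with NO LOSS in the constant
and no regularity assumption (no derivative, no continuity): on the grid `θⱼ = j h`, `h = (π/3)/n ≤ h₀`,
the increments `Dⱼ = E(θⱼ₊₁) - E(θⱼ)` satisfy `D₀ ≥ d(M/L)h²/2` (second difference at `0` plus the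
evenness `E(-h) = E(h)`, Byers–Yang time reversal `tubeEnergy_neg`) and `Dⱼ₊₁ ≥ Dⱼ + d(M/L)h²`, and
`Σⱼ (j + ½) = n²/2` telescopes to the claim. This is the discrete form of "`ρ̃` is the double
integral of the Kohn curvature `D_L(θ) = L E″(θ)/M` along `[0, π/3]`" (Kohn 1964; Scalapino–White–
Zhang 1993); the companion CEILING (curvature `≤ 2` at every base flux) is the tree's
`tubeEnergy_semiconcave` (WidthHaldaneTubeSemiconcave).

* `sub_ge_of_local_second_diff_floor` — the real-variable lemma for an even function on `[-T, T]`;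
* `tubeEnergy_pi_div_three_sub_zero_ge_of_curvature_floor` — the tube instance, `T = π/3`;
* `le_tubeStiffness_of_curvature_floor` — `d ≤ ρ̃_{L,M}(U, δ)`.

All PROVED; no definitions, no named facts. References: W. Kohn, Phys. Rev. 133 (1964) A171
(curvature formula); D. J. Scalapino, S. R. White, S. C. Zhang, PRB 47 (1993) 7995; N. Byers,
C. N. Yang, PRL 7 (1961) 46.
-/

noncomputable section

namespace Summit.HubbardSuperconductivity.HubbardSuperconductivity.Theorems.PerWidthThermodynamics

set_option linter.dupNamespace false -- summit = problem name (single-conjunct summit), D-0017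

open Summit.HubbardSuperconductivity.HubbardSuperconductivity.Theorems.WidthHaldane

/-! ### The real-variable lemma -/

/-- `Σ_{j<n} (j + ½) = n²/2`. [folklore] -/
theorem sum_range_add_half (n : ℕ) :
    ∑ j ∈ Finset.range n, ((j : ℝ) + 1 / 2) = (n : ℝ) ^ 2 / 2 := by
  induction n with
  | zero => simp
  | succ n ih =>
    rw [Finset.sum_range_succ, ih]
    push_cast
    ring

/-- **Local second-difference floor ⇒ endpoint bound, for an even function.** If `E : ℝ → ℝ` is even
and `c h² ≤ E(θ+h) + E(θ-h) - 2E(θ)` whenever `0 < h ≤ h₀` and `[θ-h, θ+h] ⊆ [-T, T]` (`T, h₀ > 0`),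
then `c T²/2 ≤ E(T) - E(0)` — no regularity needed (grid telescoping). [folklore] -/
theorem sub_ge_of_local_second_diff_floor (E : ℝ → ℝ) {T c h₀ : ℝ} (hT : 0 < T) (hh₀ : 0 < h₀)
    (heven : ∀ θ, E (-θ) = E θ)
    (hfloor : ∀ θ h : ℝ, 0 < h → h ≤ h₀ → -T ≤ θ - h → θ + h ≤ T →
      c * h ^ 2 ≤ E (θ + h) + E (θ - h) - 2 * E θ) :
    c * T ^ 2 / 2 ≤ E T - E 0 := by
  -- the grid `θⱼ = j h`, `h = T/n ≤ h₀`
  obtain ⟨n, hn1, hnh₀⟩ : ∃ n : ℕ, 1 ≤ n ∧ T ≤ n * h₀ :=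
    ⟨⌈T / h₀⌉₊, Nat.ceil_pos.mpr (div_pos hT hh₀), by
      calc T = T / h₀ * h₀ := by field_simp
        _ ≤ ⌈T / h₀⌉₊ * h₀ := mul_le_mul_of_nonneg_right (Nat.le_ceil _) hh₀.le⟩
  have hn0 : (0 : ℝ) < n := by exact_mod_cast hn1
  set h : ℝ := T / n with hh
  have hhpos : 0 < h := div_pos hT hn0
  have hnh : (n : ℝ) * h = T := by rw [hh]; field_simp
  have hhle : h ≤ h₀ := by
    rw [hh, div_le_iff₀ hn0]
    linarith
  have hhT : h ≤ T := by
    rw [← hnh]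
    exact le_mul_of_one_le_left hhpos.le (by exact_mod_cast hn1)
  -- increments `Dⱼ = E(θⱼ₊₁) - E(θⱼ)` and their floor `c h² (j + ½)`
  have hstep : ∀ j : ℕ, j < n →
      c * h ^ 2 * ((j : ℝ) + 1 / 2) ≤ E ((j + 1 : ℕ) * h) - E (j * h) := by
    intro j
    induction j with
    | zero =>
      intro _
      have h0 := hfloor 0 h hhpos hhle (by linarith) (by linarith)
      rw [zero_add, zero_sub, heven] at h0
      simp only [Nat.cast_zero, Nat.cast_succ, zero_add, zero_mul, one_mul]
      linarith
    | succ j ih =>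
      intro hj
      have ihj := ih (Nat.lt_of_succ_lt hj)
      have hjn : (j : ℝ) + 1 + 1 ≤ n := by exact_mod_cast hj
      have hjh : (0 : ℝ) ≤ j * h := mul_nonneg (Nat.cast_nonneg j) hhpos.le
      have hθm : -T ≤ ((j : ℝ) + 1) * h - h := by nlinarith
      have hθp : ((j : ℝ) + 1) * h + h ≤ T := by rw [← hnh]; nlinarith
      have h1 := hfloor (((j : ℝ) + 1) * h) h hhpos hhle hθm hθp
      have e1 : ((j : ℝ) + 1) * h + h = ((j : ℝ) + 1 + 1) * h := by ring
      have e2 : ((j : ℝ) + 1) * h - h = (j : ℝ) * h := by ring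
      rw [e1, e2] at h1
      simp only [Nat.cast_succ] at ihj ⊢
      linarith
  -- telescope and sum the floors: `Σ_{j<n} (j + ½) = n²/2`, `n h = T`
  have htel : ∑ j ∈ Finset.range n, (E ((j + 1 : ℕ) * h) - E (j * h)) = E T - E 0 := by
    rw [Finset.sum_range_sub (f := fun j : ℕ => E (j * h))]
    simp [hnh]
  have hsum := Finset.sum_le_sum fun j hj => hstep j (Finset.mem_range.mp hj)
  rw [← Finset.mul_sum, sum_range_add_half, htel] at hsum
  calc c * T ^ 2 / 2 = c * h ^ 2 * ((n : ℝ) ^ 2 / 2) := by rw [← hnh]; ring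
    _ ≤ E T - E 0 := hsum

/-! ### The tube instance -/

section Tube

variable (L M : ℕ) [NeZero L] [NeZero M] (Λ : Type) [LinearOrder Λ] [Fintype Λ]
  (e : Λ ≃ ZMod L × ZMod M)

/-- **Local Kohn-curvature floor along the twist path ⇒ the envelope rises by `(dM/2L)(π/3)²`.** If the
flux envelope `θ ↦ E_{L,M}(U; θ, N)` has second differences `≥ d (M/L) h²` at every mesh `0 < h ≤ h₀`
inside `[-π/3, π/3]`, then `E(π/3) - E(0) ≥ (d M/(2L))(π/3)²` (evenness in `θ` is Byers–Yang time
reversal, `tubeEnergy_neg`). [cite: ScalapinoWhiteZhang1993, §II] -/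
theorem tubeEnergy_pi_div_three_sub_zero_ge_of_curvature_floor (U d h₀ : ℝ) (N : ℕ) (hh₀ : 0 < h₀)
    (hfloor : ∀ θ h : ℝ, 0 < h → h ≤ h₀ → -(Real.pi / 3) ≤ θ - h → θ + h ≤ Real.pi / 3 →
      d * M / L * h ^ 2 ≤ tubeEnergy L M Λ e U (θ + h) N + tubeEnergy L M Λ e U (θ - h) N -
        2 * tubeEnergy L M Λ e U θ N) :
    d * M / L * (Real.pi / 3) ^ 2 / 2 ≤
      tubeEnergy L M Λ e U (Real.pi / 3) N - tubeEnergy L M Λ e U 0 N :=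
  sub_ge_of_local_second_diff_floor (fun θ => tubeEnergy L M Λ e U θ N) (by positivity) hh₀
    (fun θ => tubeEnergy_neg L M Λ e U θ N) hfloor

/-- **Local Kohn-curvature floor ⇒ stiffness floor, losslessly** (registered sub-goal of the crux item):
for every tube, labelling, coupling `U`, doping `δ`, constant `d` and mesh bound `h₀ > 0`, a second-
difference floor `d (M/L) h² ≤ E(θ+h) + E(θ-h) - 2E(θ)` of the flux envelope at the filling
`N = N_{L,M}(δ)` for all `0 < h ≤ h₀` inside `[-π/3, π/3]` gives `d ≤ ρ̃_{L,M}(U, δ) =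
2L[E(π/3) - E(0)]/((π/3)² M)`. [cite: ScalapinoWhiteZhang1993, §II] -/
theorem le_tubeStiffness_of_curvature_floor : ∀ (L M : ℕ) [NeZero L] [NeZero M] (Λ : Type) [LinearOrder Λ] [Fintype Λ] (e : Λ ≃ ZMod L × ZMod M) (U δ d h₀ : ℝ), 0 < h₀ → (∀ θ h : ℝ, 0 < h → h ≤ h₀ → -(Real.pi / 3) ≤ θ - h → θ + h ≤ Real.pi / 3 → d * M / L * h ^ 2 ≤ tubeEnergy L M Λ e U (θ + h) (tubeFilling L M δ) + tubeEnergy L M Λ e U (θ - h) (tubeFilling L M δ) - 2 * tubeEnergy L M Λ e U θ (tubeFilling L M δ)) → d ≤ tubeStiffness L M Λ e U δ := by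
  intro L M _ _ Λ _ _ e U δ d h₀ hh₀ hfloor
  have hL0 : (0 : ℝ) < L := by exact_mod_cast Nat.pos_of_ne_zero (NeZero.ne L)
  have hM0 : (0 : ℝ) < M := by exact_mod_cast Nat.pos_of_ne_zero (NeZero.ne M)
  have key := tubeEnergy_pi_div_three_sub_zero_ge_of_curvature_floor L M Λ e U d h₀ (tubeFilling L M δ)
    hh₀ hfloor
  rw [tubeStiffness_eq, le_div_iff₀ (by positivity)]
  have h2 := mul_le_mul_of_nonneg_left key (show (0 : ℝ) ≤ 2 * L by positivity)
  calc d * ((Real.pi / 3) ^ 2 * (M : ℝ)) = 2 * L * (d * M / L * (Real.pi / 3) ^ 2 / 2) := by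
        field_simp
    _ ≤ 2 * L * (tubeEnergy L M Λ e U (Real.pi / 3) (tubeFilling L M δ) -
          tubeEnergy L M Λ e U 0 (tubeFilling L M δ)) := h2

end Tube

end Summit.HubbardSuperconductivity.HubbardSuperconductivity.Theorems.PerWidthThermodynamics

end
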